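import Mathlib.Algebra.Group.Subgroup.Basic
import Mathlib.GroupTheory.Subgroup.Centralizer
import Mathlib.GroupTheory.Index
import Mathlib.Topology.Algebra.ContinuousMonoidHom
import Mathlib.Topology.Algebra.Group.Basic
import Literature.GroupTheory.CentralizerClassesTransport   -- ★ (CARTAN-FIN road, «CARTAN-CLASS-TRANSPORT»): `map_centralizer_singleton_mulEquiv` (`e(Z(g)) = Z(e g)`), `map_map_conj_mulEquiv` — CITED, not retyped
import HarnessLib

/-!
# Transport of centralisers, their normalisers and the Weyl index `[N(T) : T]` along a group isomorphism; the «inner square» case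

Topic `GroupTheory`; namespace `Literature.GroupTheory`.  **THEOREMS ONLY** (no definition, no instance, no notation, no named fact, no `sorry`);
Mathlib-only.  Cell `pub/hodgecm-mathlib`, crux H413 = `stmt-HodgeConjecture-24833` (lane `--kind proof --supports …`, count-neutral), ROAD «UP-TR»
(holder F0P3-p02 (g23), `F0/P3/F0P3-p02/g23/ROAD-UP-TR.v2.F0P3p02g23.md` a950f43e3d74c075): the GENERIC §1 block of brick (H6a′) «TWIST-MAPS»
(F0P3a-p09 (g11), census 2026-09-02T18:30:18Z), carved off to this seat by the holder's word 18:35:20Z («(α) GO»).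

THE MATHEMATICS (folklore).  For a group isomorphism `e : G ≃* G′` and `γ : G`: `e(Z_G(γ)) = Z_{G′}(e γ)`, `e(N_G(T)) = N_{G′}(e T)`, hence the Weyl index
`[N_{G′}(e T) : e T] = [N_G(T) : T]` (`Subgroup.relIndex` is invariant under injective maps, Mathlib `Subgroup.relIndex_map_map_of_injective` +
`Subgroup.map_equiv_normalizer_eq`).  If `e : G ≃* G` has INNER SQUARE, `e (e g) = u g u⁻¹`, then `Z_G(e (e γ)) = u Z_G(γ) u⁻¹` («the twice-twisted
torus is conjugate to the torus», `T** ∼ T`).  For a topological-group isomorphism `e : G ≃ₜ* G′` the restriction `Z_G(γ) ≃ₜ* Z_{G′}(e γ)` is again a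
topological-group isomorphism (stated as an `∃` with its value formulas, this file declaring no `def`; ★ `UnitaryGroupAdelicCentralizerProduct` has a PRIVATE
`Nonempty` form without the formulas).  These are the generic facts behind
[Rogawski1990, §12.5 p. 182–183] («the number of `ν ∈ 𝒟(T∕F)` such that `T^ν` is conjugate to `T` …», `|Ω_F(T,H)|`, `w(δ)`), used on `H_v = U(2) × U(1)`.

* §1 (over ★ `map_centralizer_singleton_mulEquiv`) `image_coe_centralizer_singleton_eq`, `map_normalizer_centralizer_singleton_eq`, `relIndex_normalizer_map_equiv`,
  `index_subgroupOf_normalizer_map_equiv`, `index_subgroupOf_normalizer_centralizer_apply_eq`.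
* §2 (inner square) `centralizer_singleton_apply_apply_eq_map_conj`, `index_subgroupOf_normalizer_centralizer_apply_apply_eq`.
* §3 (topological) `exists_continuousMulEquiv_centralizer_singleton`.

## References
* [Rogawski1990] J. D. Rogawski, *Automorphic Representations of Unitary Groups in Three Variables*, Ann. of Math. Stud. 123 (1990), §3.6 p. 29; §12.5 pp. 182–183.
* [HarishChandra1970] Harish-Chandra (notes by G. van Dijk), *Harmonic Analysis on Reductive p-adic Groups*, LNM 162 (1970), Lemma 42.
* [PlatonovRapinchuk1994] V. Platonov, A. Rapinchuk, *Algebraic Groups and Number Theory* (1994), §6.4.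
-/

set_option autoImplicit false

namespace Literature.GroupTheory

/-! ## §1 Transport along `e : G ≃* G′` -/

section Algebraic

variable {G G' : Type*} [Group G] [Group G'] (e : G ≃* G') (γ : G)

/-- Set form: `e '' Z_G(γ) = Z_{G′}(e γ)` (for measure transport along `e`). [folklore] [cite: PlatonovRapinchuk1994, §6.4] [cite: Rogawski1990, §12.5 p. 183] -/
theorem image_coe_centralizer_singleton_eq :
    e '' (Subgroup.centralizer ({γ} : Set G) : Set G) = (Subgroup.centralizer ({e γ} : Set G') : Set G') := by
  rw [← map_centralizer_singleton_mulEquiv e γ, Subgroup.coe_map]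
  rfl

/-- **`e(N_G(Z_G(γ))) = N_{G′}(Z_{G′}(e γ))`**. [folklore] [cite: Rogawski1990, §12.5 p. 182] -/
theorem map_normalizer_centralizer_singleton_eq :
    (Subgroup.normalizer (Subgroup.centralizer ({γ} : Set G) : Set G)).map e.toMonoidHom =
      Subgroup.normalizer (Subgroup.centralizer ({e γ} : Set G') : Set G') := by
  rw [Subgroup.map_equiv_normalizer_eq, map_centralizer_singleton_mulEquiv]

/-- **The Weyl index is invariant under a group isomorphism** (`relIndex` form): `(e T).relIndex N_{G′}(e T) = T.relIndex N_G(T)` for every subgroup `T`.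
[folklore] [cite: Rogawski1990, §3.6 p. 29] -/
theorem relIndex_normalizer_map_equiv (T : Subgroup G) :
    (T.map e.toMonoidHom).relIndex (Subgroup.normalizer (T.map e.toMonoidHom : Set G')) =
      T.relIndex (Subgroup.normalizer (T : Set G)) := by
  rw [← Subgroup.map_equiv_normalizer_eq, Subgroup.relIndex_map_map_of_injective _ _ e.injective]

/-- **The Weyl index is invariant under a group isomorphism** (`[N(T) : T] = (T.subgroupOf N(T)).index` form, the road's currency ★ `Ch12Sec5.weylOrder_eq_index`):
`((e T).subgroupOf N_{G′}(e T)).index = (T.subgroupOf N_G(T)).index`. [folklore] [cite: Rogawski1990, §3.6 p. 29; §12.5 p. 182] -/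
theorem index_subgroupOf_normalizer_map_equiv (T : Subgroup G) :
    ((T.map e.toMonoidHom).subgroupOf (Subgroup.normalizer (T.map e.toMonoidHom : Set G'))).index =
      (T.subgroupOf (Subgroup.normalizer (T : Set G))).index :=
  relIndex_normalizer_map_equiv e T

/-- **`[N_{G′}(Z_{G′}(e γ)) : Z_{G′}(e γ)] = [N_G(Z_G(γ)) : Z_G(γ)]`** — the Weyl index of a centraliser torus is transported by any group isomorphism
(the (H6-W) index equality for the road's twists). [folklore] [cite: Rogawski1990, §12.5 pp. 182–183] -/
theorem index_subgroupOf_normalizer_centralizer_apply_eq :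
    ((Subgroup.centralizer ({e γ} : Set G')).subgroupOf (Subgroup.normalizer (Subgroup.centralizer ({e γ} : Set G') : Set G'))).index =
      ((Subgroup.centralizer ({γ} : Set G)).subgroupOf (Subgroup.normalizer (Subgroup.centralizer ({γ} : Set G) : Set G))).index := by
  rw [← map_centralizer_singleton_mulEquiv e γ]
  exact index_subgroupOf_normalizer_map_equiv e _

end Algebraic

/-! ## §2 Conjugation and automorphisms with inner square (`T** ∼ T`) -/

section InnerSquare

variable {G : Type*} [Group G]

/-- **`T** ∼ T`**: if `e : G ≃* G` has inner square, `e (e g) = u g u⁻¹` for all `g`, then `Z_G(e (e γ)) = u Z_G(γ) u⁻¹` — twisting the twisted centraliser torus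
lands in the conjugacy class of the original one. [folklore] [cite: Rogawski1990, §12.5 p. 183] -/
theorem centralizer_singleton_apply_apply_eq_map_conj (e : G ≃* G) (u : G) (h2 : ∀ g, e (e g) = u * g * u⁻¹) (γ : G) :
    Subgroup.centralizer ({e (e γ)} : Set G) = (Subgroup.centralizer ({γ} : Set G)).map (MulAut.conj u).toMonoidHom := by
  rw [map_centralizer_singleton_mulEquiv, MulAut.conj_apply, h2]

/-- The Weyl index along the square of such an `e`: `[N(Z(e (e γ))) : Z(e (e γ))] = [N(Z(γ)) : Z(γ)]` (also immediate from §1 twice; recorded for consumers).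
[folklore] [cite: Rogawski1990, §12.5 pp. 182–183] -/
theorem index_subgroupOf_normalizer_centralizer_apply_apply_eq (e : G ≃* G) (γ : G) :
    ((Subgroup.centralizer ({e (e γ)} : Set G)).subgroupOf (Subgroup.normalizer (Subgroup.centralizer ({e (e γ)} : Set G) : Set G))).index =
      ((Subgroup.centralizer ({γ} : Set G)).subgroupOf (Subgroup.normalizer (Subgroup.centralizer ({γ} : Set G) : Set G))).index := by
  rw [index_subgroupOf_normalizer_centralizer_apply_eq, index_subgroupOf_normalizer_centralizer_apply_eq]

end InnerSquare

/-! ## §3 Topological groups: the restricted isomorphism `Z_G(γ) ≃ₜ* Z_{G′}(e γ)` -/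

section Topological

variable {G G' : Type*} [Group G] [TopologicalSpace G] [Group G'] [TopologicalSpace G']

/-- **Restriction of a topological-group isomorphism to centralisers**: for `e : G ≃ₜ* G′` and `γ : G` there is a topological-group isomorphism
`j : Z_G(γ) ≃ₜ* Z_{G′}(e γ)` with `j t = e t` (and `j⁻¹ t′ = e⁻¹ t′`). Stated as an existence with its value formulas (no definition is declared).
[folklore] [cite: Rogawski1990, §12.5 p. 183] -/
theorem exists_continuousMulEquiv_centralizer_singleton (e : G ≃ₜ* G') (γ : G) :
    ∃ j : ↥(Subgroup.centralizer ({γ} : Set G)) ≃ₜ* ↥(Subgroup.centralizer ({e γ} : Set G')),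
      (∀ t, ((j t : ↥(Subgroup.centralizer ({e γ} : Set G'))) : G') = e (t : G)) ∧
      (∀ t', ((j.symm t' : ↥(Subgroup.centralizer ({γ} : Set G))) : G) = e.symm (t' : G')) := by
  have hmem : ∀ t : ↥(Subgroup.centralizer ({γ} : Set G)), e (t : G) ∈ Subgroup.centralizer ({e γ} : Set G') := by
    intro t
    have ht := Subgroup.mem_centralizer_singleton_iff.1 t.2
    rw [Subgroup.mem_centralizer_singleton_iff, ← map_mul, ← map_mul, ht]
  have hmem' : ∀ t' : ↥(Subgroup.centralizer ({e γ} : Set G')), e.symm (t' : G') ∈ Subgroup.centralizer ({γ} : Set G) := by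
    intro t'
    have ht' := Subgroup.mem_centralizer_singleton_iff.1 t'.2
    rw [Subgroup.mem_centralizer_singleton_iff]
    apply e.injective
    rw [map_mul, map_mul, ContinuousMulEquiv.apply_symm_apply, ht']
  let f : ↥(Subgroup.centralizer ({γ} : Set G)) ≃* ↥(Subgroup.centralizer ({e γ} : Set G')) :=
    { toFun := fun t => ⟨e (t : G), hmem t⟩
      invFun := fun t' => ⟨e.symm (t' : G'), hmem' t'⟩
      left_inv := fun t => by ext; simp
      right_inv := fun t' => by ext; simp
      map_mul' := fun s t => by ext; simp }
  have hf : Continuous f := (e.continuous.comp continuous_subtype_val).subtype_mk _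
  have hf' : Continuous f.symm := (e.symm.continuous.comp continuous_subtype_val).subtype_mk _
  exact ⟨{ f with continuous_toFun := hf, continuous_invFun := hf' }, fun _ => rfl, fun _ => rfl⟩

end Topological

end Literature.GroupTheory
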